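import Literature.Analysis.FluidPDE.TorusGradientVorticityLp
import Summits.NavierStokesRegularity.FunctionalMining.StrainMoment
import HarnessLib

/-!
# FunctionalMining — Calderón–Zygmund control of `|∇v|` by `|S|` in `L^s(T³)`, Bochner form

Search for candidate a priori estimates; no regularity claim. Cell `pub-nsfunc`, prove seat
(gen 9). A static input of the K0 rows `ES.absS.q|T_LD|G1` (strain moments, SIEVELD §3.3:
"`‖∇u‖_r ≤ K′_r‖S‖_r`"). The tree's componentwise `eLpNorm` bound
`BDSV.exists_eLpNorm_partialDeriv_le_twoStrain` (`‖(∂ₖu)ᵢ‖_p ≤ C∑ⱼ‖(∂ᵢu)ⱼ + (∂ⱼu)ᵢ‖_p`, Miller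
2019 §3 [Miller2019: arXiv 2019 = ARMA 2020] / periodic Calderón–Zygmund) rewritten with Bochner
integrals of the cell's densities `|∇v| = (∑ⱼ‖∂ⱼv‖²)^{1/2}` and `|S| = (torusStrainSqAt v)^{1/2}`
(`StrainMoment.lean`): for `1 < s`
there is `K ≥ 0` with `(∫|∇v|^s)^{1/s} ≤ K(∫|S|^s)^{1/s}` for every smooth divergence-free `v` on
`T³` (`|∇v| ≤ ∑ⱼᵢ|∂ⱼvᵢ|`, `|(∂ᵢv)ⱼ + (∂ⱼv)ᵢ| = 2|Sᵢⱼ| ≤ 2|S|`, Minkowski; `K = 54C`). Companion of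
the tree's `Torus.exists_gradLs_le_vorticityLs`.

## Main statement

* `exists_gradLs_le_strainLs` — `(∫|∇v|^s)^{1/s} ≤ K (∫|S|^s)^{1/s}` on `T³`, `1 < s`.
-/

noncomputable section

open Set MeasureTheory Function Real
open scoped InnerProductSpace RealInnerProductSpace ENNReal NNReal

namespace Summit.NavierStokesRegularity.FunctionalMining

open Literature.Analysis.FunctionSpaces Literature.Analysis.FluidPDE

namespace StrainTensor

/-- `√(∑ aᵢ²) ≤ ∑ aᵢ` for `aᵢ ≥ 0`. [folklore] -/
private theorem sqrt_sum_sq_le_sum {ι : Type*} [Fintype ι] (a : ι → ℝ) (ha : ∀ i, 0 ≤ a i) :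
    Real.sqrt (∑ i, a i ^ 2) ≤ ∑ i, a i := by
  have hS : 0 ≤ ∑ i, a i := Finset.sum_nonneg fun i _ => ha i
  refine Real.sqrt_le_iff.2 ⟨hS, ?_⟩
  calc ∑ i, a i ^ 2 = ∑ i, a i * a i := Finset.sum_congr rfl fun i _ => sq (a i)
    _ ≤ ∑ i, a i * ∑ k, a k := Finset.sum_le_sum fun i _ =>
        mul_le_mul_of_nonneg_left (Finset.single_le_sum (fun k _ => ha k) (Finset.mem_univ i))
          (ha i)
    _ = (∑ i, a i) ^ 2 := by rw [← Finset.sum_mul]; ring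

/-- Pointwise `|(∂ᵢv)ⱼ + (∂ⱼv)ᵢ| ≤ 2|S|`: one doubled strain entry is at most twice the
Frobenius norm. [folklore] -/
theorem abs_twoStrain_le (v : UnitAddTorus (Fin 3) → EuclideanSpace ℝ (Fin 3))
    (x : UnitAddTorus (Fin 3)) (i j : Fin 3) :
    |Torus.partialDeriv i v x j + Torus.partialDeriv j v x i| ≤
      2 * Real.sqrt (torusStrainSqAt v x) := by
  have h1 : ((Torus.partialDeriv i v x j + Torus.partialDeriv j v x i) / 2) ^ 2 ≤
      torusStrainSqAt v x := by
    unfold torusStrainSqAt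
    have hle : ((Torus.partialDeriv i v x j + Torus.partialDeriv j v x i) / 2) ^ 2 ≤
        ∑ j', ((Torus.partialDeriv j' v x j + Torus.partialDeriv j v x j') / 2) ^ 2 :=
      Finset.single_le_sum (f := fun j' => ((Torus.partialDeriv j' v x j +
        Torus.partialDeriv j v x j') / 2) ^ 2) (fun _ _ => sq_nonneg _) (Finset.mem_univ i)
    exact hle.trans (Finset.single_le_sum (f := fun i' => ∑ j', ((Torus.partialDeriv j' v x i' +
      Torus.partialDeriv i' v x j') / 2) ^ 2) (fun _ _ => Finset.sum_nonneg fun _ _ => sq_nonneg _)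
        (Finset.mem_univ j))
  have h2 : |(Torus.partialDeriv i v x j + Torus.partialDeriv j v x i) / 2| ≤
      Real.sqrt (torusStrainSqAt v x) := Real.abs_le_sqrt h1
  rw [abs_div, abs_of_pos (by norm_num : (0 : ℝ) < 2)] at h2
  linarith

/-- **Calderón–Zygmund control of `|∇v|` by `|S|` in `L^s(T³)`, `1 < s`, Bochner form.** There is
`K ≥ 0` such that for every smooth divergence-free `v` on `T³`,
`(∫ (∑ⱼ‖∂ⱼv‖²)^{s/2})^{1/s} ≤ K (∫ (torusStrainSqAt v)^{s/2})^{1/s}` (both written with `√·^s`).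
From `BDSV.exists_eLpNorm_partialDeriv_le_twoStrain` by `|∇v| ≤ ∑ⱼᵢ|∂ⱼvᵢ|`, `|2Sᵢⱼ| ≤ 2|S|` and
Minkowski; `K = 54C`.
[cite: Miller2019, §3 (before Prop. 3.1: the strain-to-gradient operator is Calderón–Zygmund bounded on L^p, 1 < p < ∞)] -/
theorem exists_gradLs_le_strainLs {s : ℝ} (hs : 1 < s) :
    ∃ K : ℝ, 0 ≤ K ∧ ∀ v : UnitAddTorus (Fin 3) → EuclideanSpace ℝ (Fin 3), Torus.IsSmooth v →
      Torus.IsDivFree v →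
      (∫ x, Real.sqrt (∑ j, ‖Torus.partialDeriv j v x‖ ^ 2) ^ s) ^ (1 / s) ≤
        K * (∫ x, Real.sqrt (torusStrainSqAt v x) ^ s) ^ (1 / s) := by
  have hs0 : 0 < s := by linarith
  set q : ℝ≥0∞ := ENNReal.ofReal s with hq
  have hq1 : 1 < q := by rw [hq]; exact ENNReal.one_lt_ofReal.2 hs
  have hqtop : q < ⊤ := ENNReal.ofReal_lt_top
  have hq0 : q ≠ 0 := (zero_lt_one.trans hq1).ne'
  have hqr : q.toReal = s := ENNReal.toReal_ofReal hs0.le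
  obtain ⟨C, hC⟩ := BDSV.exists_eLpNorm_partialDeriv_le_twoStrain hq1 hqtop
  refine ⟨54 * C, by positivity, fun v hv hdiv => ?_⟩
  set f : UnitAddTorus (Fin 3) → ℝ :=
    fun x => Real.sqrt (∑ j, ‖Torus.partialDeriv j v x‖ ^ 2) with hf
  set g : UnitAddTorus (Fin 3) → ℝ := fun x => Real.sqrt (torusStrainSqAt v x) with hg
  have hDc : ∀ j, Continuous (Torus.partialDeriv j v) := fun j => (hv.partialDeriv j).continuous
  have hDic : ∀ j i, Continuous fun x => Torus.partialDeriv j v x i :=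
    fun j i => (EuclideanSpace.proj i).continuous.comp (hDc j)
  have hfc : Continuous f :=
    Real.continuous_sqrt.comp (continuous_finsetSum _ fun j _ => ((hDc j).norm).pow 2)
  have hSc : Continuous fun x => torusStrainSqAt v x := by
    unfold torusStrainSqAt
    exact continuous_finsetSum _ fun i _ => continuous_finsetSum _ fun j _ =>
      (((hDic j i).add (hDic i j)).div_const 2).pow 2
  have hgc : Continuous g := Real.continuous_sqrt.comp hSc
  have hf0 : ∀ x, 0 ≤ f x := fun x => Real.sqrt_nonneg _
  have hg0 : ∀ x, 0 ≤ g x := fun x => Real.sqrt_nonneg _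
  -- pointwise: `f ≤ ∑ⱼᵢ |∂ⱼvᵢ|`, `|(∂ᵢv)ⱼ + (∂ⱼv)ᵢ| ≤ 2g`
  set F : Fin 3 × Fin 3 → UnitAddTorus (Fin 3) → ℝ :=
    fun ji x => |Torus.partialDeriv ji.1 v x ji.2| with hF
  have hf_le : ∀ x, f x ≤ ∑ ji, F ji x := by
    intro x
    have h1 : f x ≤ ∑ j, ‖Torus.partialDeriv j v x‖ :=
      sqrt_sum_sq_le_sum (fun j => ‖Torus.partialDeriv j v x‖) fun j => norm_nonneg _
    have h2 : ∀ j, ‖Torus.partialDeriv j v x‖ ≤ ∑ i, |Torus.partialDeriv j v x i| := by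
      intro j
      rw [EuclideanSpace.norm_eq]
      have e : ∀ i, ‖Torus.partialDeriv j v x i‖ ^ 2 = |Torus.partialDeriv j v x i| ^ 2 :=
        fun i => by rw [Real.norm_eq_abs]
      simp only [e]
      exact sqrt_sum_sq_le_sum _ fun i => abs_nonneg _
    calc f x ≤ ∑ j, ‖Torus.partialDeriv j v x‖ := h1
      _ ≤ ∑ j, ∑ i, |Torus.partialDeriv j v x i| := Finset.sum_le_sum fun j _ => h2 j
      _ = ∑ ji, F ji x := by rw [hF, ← Fintype.sum_prod_type']
  have htwo_le : ∀ x i j, |Torus.partialDeriv i v x j + Torus.partialDeriv j v x i| ≤ 2 * g x :=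
    fun x i j => abs_twoStrain_le v x i j
  -- Minkowski: `‖f‖_q ≤ ∑ⱼᵢ ‖∂ⱼvᵢ‖_q`
  have hFm : ∀ ji, AEStronglyMeasurable (F ji) volume :=
    fun ji => ((hDic ji.1 ji.2).abs).aestronglyMeasurable
  have hstep1 : eLpNorm f q volume ≤ ∑ ji, eLpNorm (F ji) q volume := by
    have h1 : eLpNorm f q volume ≤ eLpNorm (fun x => ∑ ji, F ji x) q volume :=
      eLpNorm_mono_real fun x => by
        rw [Real.norm_eq_abs, abs_of_nonneg (hf0 x)]
        exact hf_le x
    have e : (fun x => ∑ ji, F ji x) = ∑ ji, F ji := by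
      funext x
      simp only [Finset.sum_apply]
    rw [e] at h1
    exact h1.trans (eLpNorm_sum_le (fun ji _ => hFm ji) hq1.le)
  -- Calderón–Zygmund for each entry, and `‖(∂ᵢv)ⱼ + (∂ⱼv)ᵢ‖_q ≤ 2‖g‖_q`
  have hstep2 : ∀ ji, eLpNorm (F ji) q volume ≤ C * (6 * eLpNorm g q volume) := by
    intro ji
    have h1 : eLpNorm (F ji) q volume ≤
        eLpNorm (fun x => Torus.partialDeriv ji.1 v x ji.2) q volume :=
      eLpNorm_mono fun x => by simp [hF]
    have h2 := hC v hv hdiv ji.2 ji.1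
    have h3 : ∑ j : Fin 3, eLpNorm (fun x => Torus.partialDeriv ji.2 v x j +
        Torus.partialDeriv j v x ji.2) q volume ≤ 6 * eLpNorm g q volume := by
      have h4 : ∀ j, eLpNorm (fun x => Torus.partialDeriv ji.2 v x j +
          Torus.partialDeriv j v x ji.2) q volume ≤ 2 * eLpNorm g q volume := by
        intro j
        have h5 : eLpNorm (fun x => Torus.partialDeriv ji.2 v x j +
            Torus.partialDeriv j v x ji.2) q volume ≤ eLpNorm (fun x => 2 * g x) q volume :=
          eLpNorm_mono_real fun x => by
            rw [Real.norm_eq_abs]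
            exact htwo_le x ji.2 j
        have h6 : eLpNorm (fun x => 2 * g x) q volume = 2 * eLpNorm g q volume := by
          have e : (fun x => 2 * g x) = (2 : ℝ) • g := by funext x; simp
          rw [e, eLpNorm_const_smul, Real.enorm_eq_ofReal zero_le_two, ENNReal.ofReal_ofNat]
        exact h5.trans h6.le
      calc ∑ j : Fin 3, eLpNorm (fun x => Torus.partialDeriv ji.2 v x j +
            Torus.partialDeriv j v x ji.2) q volume
          ≤ ∑ _j : Fin 3, 2 * eLpNorm g q volume := Finset.sum_le_sum fun j _ => h4 j
        _ = 6 * eLpNorm g q volume := by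
            rw [Finset.sum_const, Finset.card_univ, Fintype.card_fin, nsmul_eq_mul]
            push_cast; ring
    calc eLpNorm (F ji) q volume
        ≤ eLpNorm (fun x => Torus.partialDeriv ji.1 v x ji.2) q volume := h1
      _ ≤ C * ∑ j : Fin 3, eLpNorm (fun x => Torus.partialDeriv ji.2 v x j +
          Torus.partialDeriv j v x ji.2) q volume := h2
      _ ≤ C * (6 * eLpNorm g q volume) := by gcongr
  have hmain : eLpNorm f q volume ≤ ((54 * C : ℝ≥0) : ℝ≥0∞) * eLpNorm g q volume := by
    calc eLpNorm f q volume ≤ ∑ ji : Fin 3 × Fin 3, eLpNorm (F ji) q volume := hstep1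
      _ ≤ ∑ _ji : Fin 3 × Fin 3, (C : ℝ≥0∞) * (6 * eLpNorm g q volume) :=
          Finset.sum_le_sum fun ji _ => hstep2 ji
      _ = ((54 * C : ℝ≥0) : ℝ≥0∞) * eLpNorm g q volume := by
          rw [Finset.sum_const, Finset.card_univ, Fintype.card_prod, Fintype.card_fin, nsmul_eq_mul]
          push_cast
          ring
  -- Bochner form
  have conv : ∀ {φ : UnitAddTorus (Fin 3) → ℝ}, Continuous φ → (∀ x, 0 ≤ φ x) →
      eLpNorm φ q volume = ENNReal.ofReal ((∫ x, φ x ^ s) ^ (1 / s)) := by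
    intro φ hφ hφ0
    rw [MemLp.eLpNorm_eq_integral_rpow_norm hq0 hqtop.ne
      (hφ.memLp_of_hasCompactSupport (HasCompactSupport.of_compactSpace φ)), hqr, one_div]
    congr 2
    exact integral_congr_ae (ae_of_all _ fun x => by
      simp only [Real.norm_eq_abs, abs_of_nonneg (hφ0 x)])
  rw [conv hfc hf0, conv hgc hg0] at hmain
  have hB0 : 0 ≤ (∫ x, g x ^ s) ^ (1 / s) :=
    Real.rpow_nonneg (integral_nonneg fun x => Real.rpow_nonneg (hg0 x) _) _
  have e : ((54 * C : ℝ≥0) : ℝ≥0∞) * ENNReal.ofReal ((∫ x, g x ^ s) ^ (1 / s)) =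
      ENNReal.ofReal (54 * C * (∫ x, g x ^ s) ^ (1 / s)) := by
    rw [ENNReal.ofReal_mul (by positivity), ← ENNReal.ofReal_coe_nnreal]
    push_cast
    rfl
  rw [e] at hmain
  exact (ENNReal.ofReal_le_ofReal_iff (by positivity)).1 hmain

end StrainTensor

end Summit.NavierStokesRegularity.FunctionalMining
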